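import Summits.QuantumFields.YangMills.Theorems.BalabanUVNodesN07NormalisationCrossingEnds
import Summits.QuantumFields.YangMills.Theorems.BalabanUVNodesN07DataAxialTopBox
import Summits.QuantumFields.YangMills.Theorems.BalabanUVNodesN07SplitClauseBoxesCubeDomains
import Summits.QuantumFields.YangMills.Theorems.BalabanUVNodesN07ShearSizeTopBox
import HarnessLib

/-!
# N07 [B11] (= [15] = [Balaban1985Variational]) Sect. F — THE CHART's DATUM `B` UNDER THE NORMALISED GAUGE, **TOP ROWS**: print's (160), first case,
# «|B(x,x′)| < |x − y|·4L²ε₁ for ⟨x,x′⟩ ∈ □̃″_k^{(k)}» at the objects of record — for every top-level constraint bond of print's local family `D″`,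
# `‖(1∕i) log 𝒜_j(U^u)(c)‖ ≤ 2(d−1)·n·δ̂`, modulo the ONE displayed letter `δ̂` = the plaquette smallness of the level-`j` averages on the datum's top box («(7) for V»)

Cell `pub-ymgap`, seat `pub-ymgap-dag-n07-e` g23 (FAN-OUT §N07 row s3; LANE OWNER of the K0 road), MODULE 62 (announced in LANDED-61, cell bus 2026-08-28T18:38Z).
`--kind proof --supports stmt-QuantumFields-20541 --as helper` (K0⁷; dag-lead KEY MAP v2); count-neutral; def-free.
[15] = [Balaban1985Variational]; [3] = [Balaban1985Averaging]; [4] = [Balaban1984PropagatorsII].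

WHY.  MODULE 59's HCHART-MEET-NORM (p653394) asks the chart lane for a datum `B : BondIdx D″ → MatA N` with (160) near rows and (155) far rows; MODULES 60∕61 (p655779∕p657543) read the
normalisation of record as `𝒜_{j(c)}(U^u)(c) = M^{j(c)}(U″)(c)`, `U″ = (U^w)^{h̄}`, on EVERY `c : BondIdx D″`.  This file closes the TOP level end to end: at `j(c) = j`, `M^j(U″)(c) = (V^h)(c)`
with `V = M^j(U^w) = M^j U` (`w` residual) and `h = axialGauge V (lo j) (hi j)` the data's coarse axial gauge on the datum's top box ((147)) — so MODULE 40's torus non-abelian Poincaré rows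
(`dist1 (V^h c) ≤ (d−1)·n·δ̂` on the box bonds, p606565) and the principal logarithm's Lipschitz bound (`‖log X‖ ≤ 2‖X − 1‖` for `‖X − 1‖ ≤ ½`) give the row.  The bond IS a box bond: its
cell-site ends lie in the level box by dag-n07-w4's `levelBoxes_of_Om_subset_cubeDomains` (`Ω″_j ⊆ □_j^{(j)}`), its outer end by the same lemma's (O) clause, and a non-wrapping box turns
two ends into membership (dag-n07-w6 `mem_boxBonds_of_ends_mem_box`).
THE DISPLAYED LETTER `δ̂` («(7) for V», print p. 303 «Now we use the assumption (7) for V, hence for V′»): the plaquettes of `M^j U` based in the top box `[lo j, hi j]` are `< δ̂`.  On `□_j ∩ Ω_j`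
these are DATA plaquettes (the token's `AgreeOn (genSet …) … W` + `DataSmall7PTop … δ W`); on the dent `□_j ∖ Ω_j` (outward datums) they are ONCE-AVERAGED level-(j−1) data ([15] (13);
n07-e MODULE 1 `…N07SectAObjects`) — both δ-type; the by-name supplier of `δ̂` from the token's hypotheses (which top-box plaquettes are which) is NOT in this file (SPEC §10 (C1a)).

WHAT IS PROVED (sorry-free; no definition; axioms standard; by-name composition — NOTHING of [15]∕[3]∕[4] analysis).  ★★★ `NrmOfRecord.norm_mlog_shearedAvgIter_top_le`: under
`NrmOfRecord F N Mc ρ … u A` (MODULE 60), `Adm22 D″ R M_b` with `2L ≤ R·M_b + 1` (MODULE 59's `hAdmD`), `L ≤ ρ`, the top-box letter `δ̂ ≥ 0` with `(d−1)·n·δ̂ ≤ ½` on a non-wrapping box of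
`n + 1` labels (`hi j ≤ lo j + n`, `n + 1 < N_j`): for every `c : PBond (F.P K) j` with `D″.LamBond j c`, `‖log 𝒜_j(U^u)(c)‖ ≤ 2·((d−1)·n·δ̂)` — the chart's top rows with `β₁ := 2(d−1)nδ̂`
(uniform ⇒ centred, MODULE 40 `norm_datum_dataAxial_le_centred`'s device); ★ `NrmOfRecord.shearedAvgIter_top_eq_dataAxial_of_lamBond` — the identity `𝒜_j(U^u)(c) = (V^h)(c)`, `V = M^j U`, on
every top constraint bond (MODULE 61 + `iter_gaugeAct_blockLift` + `iter_gaugeAct_of_isResidual`).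

HONEST SCOPE.  Count-neutral; `NrmOfRecord`, `Adm22`, `δ̂` and the box numerics are HYPOTHESES; the dent's near rows (print's [6] Lemma-1 step with the (j−1)-data's plaquettes) and the
collars' far rows ((145)–(146), (155)) are NOT here (SPEC §10: LOCATED-DENT-ROWS ∕ LOCATED-COLLAR-ROWS, data lane, unseated); HS3NORM ∕ HCHART-MEET-NORM ∕ HBUDGET-NORM stay displayed; stub
1-G‴ ∕ K0⁷ ∕ K1⁹ NOT closed; N07 ∕ N05 NOT discharged; counts unmoved (typed 28∕28 · discharged 5∕27); one finite 𝕋⁴ programme at fixed ε — the route closes the conditional finite-𝕋⁴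
rung `BalabanLadder.UV` ONLY; the YM mass gap (Clay) is NOT proved by any of this; nothing continuum ∕ ℝ⁴ ∕ OS.  No `sorry`, no `def`, no `instance`, no `notation`.

References: [15] (144) p. 300, (147) p. 301, (154) p. 302, (160) p. 303; [3] (21) p. 21, (88) p. 31; [4] (2.1)–(2.3) p. 224.
-/

set_option autoImplicit false

noncomputable section

namespace Summit.QuantumFields.YangMills.BalabanUVNodes.N07NormalisationTopRows

open scoped Matrix.Norms.L2Operator
open Literature.MathematicalPhysics.QuantumFieldTheory.Balaban1983to89
open Literature.MathematicalPhysics.QuantumFieldTheory.Balaban1983to89.Node00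
open T4Continuum (T4Family)
open T4AxialGaugeSmallField (axialGauge boxPlaqs boxBonds castSite)
open B12GaugeOrbits021 (IsResidual iter_gaugeAct_of_isResidual)
open B15Eq177GaugeInvariance (blockLift)
open B14DomainGeom (Pt)
open B8Eq131Cubes (sqLo sqHi)
open B6SectADomainsV1 (Domains)
open B6SectAOperatorsV1 (BondIdx)
open GaugeField (gaugeAct)
open ExpMeanLog (expMeanLogSU)
open MatrixLog (mlog norm_mlog_le_two_mul)
open Summit.QuantumFields.Balaban3D.Carriers (radialContourData)
open Summit.QuantumFields.YangMills.Theorems.FlatCubeOpsText (Adm22)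
open Summit.QuantumFields.YangMills.BalabanUVNodes.N07NormalisationOfRecord (NrmOfRecord)
open Summit.QuantumFields.YangMills.BalabanUVNodes.N07NormalisationCrossingEnds (NrmOfRecord.exists_rep_bondIdx)
open Summit.QuantumFields.YangMills.BalabanUVNodes.N09AxialSelectionExists (iter_gaugeAct_blockLift)
open Summit.QuantumFields.YangMills.BalabanUVNodes.N07DataAxialTopBox (norm_datum_dataAxial_le)
open Summit.QuantumFields.YangMills.BalabanUVNodes.N07ShearSizeTopBox (mem_boxBonds_of_ends_mem_box)
open Summit.QuantumFields.YangMills.BalabanUVNodes.N07SplitClauseBoxesCubeDomains (levelBoxes_of_Om_subset_cubeDomains)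

variable {F : T4Family} {N : ℕ} [NeZero N]

/-- ★ **THE TOP IDENTITY ON EVERY TOP CONSTRAINT BOND**: under the normalisation of record and the (2.2) collar of print's local family `D″` (`Adm22 D″ R M_b`, `2L ≤ R·M_b + 1`), for every
`c : PBond (F.P K) j` with `D″.LamBond j c`: `𝒜_j(U^u)(c) = (V^h)(c)` with `V = M^j U` the record's level-`j` averages and `h = axialGauge V (lo j) (hi j)` their coarse axial gauge on the
datum's top box — MODULE 61 `NrmOfRecord.exists_rep_bondIdx` at the index bond `⟨⟨j, c⟩, ·⟩`, `M^j((U^w)^{h̄}) = (M^j(U^w))^h` (`iter_gaugeAct_blockLift`), `M^j(U^w) = M^j U` (`w` residual).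
[cite: Balaban1985Variational, (147) p.301, (154) p.302; Balaban1985Averaging, (88) p.31] -/
theorem NrmOfRecord.shearedAvgIter_top_eq_dataAxial_of_lamBond {Mc ρ : ℕ} {ν : Stage7Numerics} {M : ℕ} {g : ℕ → ℝ} {K k : ℕ} {s : SeqOfRecord F ν M g K k}
    {U : GaugeField (F.P K) 0 (SU N)} {j : ℕ} {idx : Pt (F.P K).d} {u : GaugeTransf (F.P K) 0 (SU N)} {A : PBond (F.P K) 0 → MatA N}
    (hN : NrmOfRecord F N Mc ρ ν M g K k s U j idx u A) (hk : j ≤ (F.P K).m + (F.P K).K) {R Mb : ℕ}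
    (hAdm : Adm22 (domainsMeet (cubeDomains (F.P K) (cornerP (F.P K) Mc ρ idx) (sideP (F.P K) Mc ρ) ρ j hk) (domainsOfSeq s.Ω j hk)) R Mb)
    (hRM : 2 * (F.P K).L ≤ R * Mb + 1) (c : PBond (F.P K) j)
    (hc : (domainsMeet (cubeDomains (F.P K) (cornerP (F.P K) Mc ρ idx) (sideP (F.P K) Mc ρ) ρ j hk) (domainsOfSeq s.Ω j hk)).LamBond j c) :
    shearedAvgIter (avOfRecord F N K) (fun i => radialContourData (F.P K) i (SU N)) (loopAvgBlockOp expMeanLogSU) (gaugeAct u U) j c =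
      gaugeAct (axialGauge (Averaging.iter (avOfRecord F N K) j U)
          (sqLo (F.P K).L (cornerP (F.P K) Mc ρ idx) ρ j j - 1) (sqHi (F.P K).L (cornerP (F.P K) Mc ρ idx) (sideP (F.P K) Mc ρ) ρ j j + 1))
        (Averaging.iter (avOfRecord F N K) j U) c := by
  obtain ⟨w, hres, -, hall⟩ := NrmOfRecord.exists_rep_bondIdx hN hk hAdm hRM
  have hlt : j < (domainsMeet (cubeDomains (F.P K) (cornerP (F.P K) Mc ρ idx) (sideP (F.P K) Mc ρ) ρ j hk) (domainsOfSeq s.Ω j hk)).k + 1 := by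
    show j < min j j + 1
    rw [min_self]; exact Nat.lt_succ_self j
  have hid := hall ⟨⟨⟨j, hlt⟩, c⟩, hc⟩
  have hV : Averaging.iter (avOfRecord F N K) j (gaugeAct w U) = Averaging.iter (avOfRecord F N K) j U :=
    iter_gaugeAct_of_isResidual (avOfRecord F N K) hk hres U
  rw [hV] at hid
  rw [hid, iter_gaugeAct_blockLift (avOfRecord F N K) hk _ (gaugeAct w U), hV]

/-- ★★★ **THE TOP ROWS OF THE CHART's DATUM `B` — print's (160), first case, at the objects of record**: under the normalisation of record, the (2.2) collar of `D″`, `L ≤ ρ`, and the displayed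
top-box letter `δ̂ ≥ 0` («(7) for V»: the plaquettes of `M^j U` based in `[lo j, hi j]` are `< δ̂`; `hi j ≤ lo j + n`, `n + 1 < N_j`, `(d−1)·n·δ̂ ≤ ½`), EVERY top constraint bond `c` of `D″`
carries `‖log 𝒜_j(U^u)(c)‖ ≤ 2·((d−1)·n·δ̂)` — the δ-LINEAR near row the budget charges to `C·δ` (`β₁ := 2(d−1)nδ̂`, `n ≈ M′ + 2ρ + 3`).  §-identity ∘ MODULE 40 `norm_datum_dataAxial_le`
(`β := log`, `C = 2`, `r = ½`; `‖log X‖ ≤ 2‖X − 1‖`, [3] (21)) on the box bond (dag-n07-w4 `levelBoxes_of_Om_subset_cubeDomains` + dag-n07-w6 `mem_boxBonds_of_ends_mem_box`).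
[cite: Balaban1985Variational, (160) p.303, (147) p.301, (144) p.300; Balaban1985Averaging, (21) p.21, (88) p.31; Balaban1984PropagatorsII, (2.1)–(2.3) p.224] -/
theorem NrmOfRecord.norm_mlog_shearedAvgIter_top_le {Mc ρ : ℕ} {ν : Stage7Numerics} {M : ℕ} {g : ℕ → ℝ} {K k : ℕ} {s : SeqOfRecord F ν M g K k}
    {U : GaugeField (F.P K) 0 (SU N)} {j : ℕ} {idx : Pt (F.P K).d} {u : GaugeTransf (F.P K) 0 (SU N)} {A : PBond (F.P K) 0 → MatA N}
    (hN : NrmOfRecord F N Mc ρ ν M g K k s U j idx u A) (hk : j ≤ (F.P K).m + (F.P K).K) (hj1 : 1 ≤ j) (hLρ : (F.P K).L ≤ ρ) {R Mb : ℕ}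
    (hAdm : Adm22 (domainsMeet (cubeDomains (F.P K) (cornerP (F.P K) Mc ρ idx) (sideP (F.P K) Mc ρ) ρ j hk) (domainsOfSeq s.Ω j hk)) R Mb)
    (hRM : 2 * (F.P K).L ≤ R * Mb + 1)
    {δ' : ℝ} (hδ : 0 ≤ δ')
    (hV : PlaqSmallOn (boxPlaqs (sqLo (F.P K).L (cornerP (F.P K) Mc ρ idx) ρ j j - 1) (sqHi (F.P K).L (cornerP (F.P K) Mc ρ idx) (sideP (F.P K) Mc ρ) ρ j j + 1)) δ'
      (Averaging.iter (avOfRecord F N K) j U))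
    {n : ℕ} (hn : ∀ κ, (sqHi (F.P K).L (cornerP (F.P K) Mc ρ idx) (sideP (F.P K) Mc ρ) ρ j j + 1) κ ≤ (sqLo (F.P K).L (cornerP (F.P K) Mc ρ idx) ρ j j - 1) κ + n)
    (hnN : n + 1 < (F.P K).sitesPerDir j) (hr : (((F.P K).d - 1 : ℕ) : ℝ) * n * δ' ≤ 1 / 2) (c : PBond (F.P K) j)
    (hc : (domainsMeet (cubeDomains (F.P K) (cornerP (F.P K) Mc ρ idx) (sideP (F.P K) Mc ρ) ρ j hk) (domainsOfSeq s.Ω j hk)).LamBond j c) :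
    ‖mlog ((shearedAvgIter (avOfRecord F N K) (fun i => radialContourData (F.P K) i (SU N)) (loopAvgBlockOp expMeanLogSU) (gaugeAct u U) j c : SU N) : MatA N)‖ ≤
      2 * ((((F.P K).d - 1 : ℕ) : ℝ) * n * δ') := by
  rw [NrmOfRecord.shearedAvgIter_top_eq_dataAxial_of_lamBond hN hk hAdm hRM c hc]
  -- the canonical boxes of the datum's cube tower (MODULE 59's four equation binders)
  set D'' := domainsMeet (cubeDomains (F.P K) (cornerP (F.P K) Mc ρ idx) (sideP (F.P K) Mc ρ) ρ j hk) (domainsOfSeq s.Ω j hk) with hD''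
  set lo : ℕ → Pt (F.P K).d := fun j' => if j' = 0 then (fun i => ((F.P K).L : ℤ) * (sqLo (F.P K).L (cornerP (F.P K) Mc ρ idx) ρ j 1 i - 1))
    else sqLo (F.P K).L (cornerP (F.P K) Mc ρ idx) ρ j j' - 1 with hlo
  set hi : ℕ → Pt (F.P K).d := fun j' => if j' = 0 then
      (fun i => ((F.P K).L : ℤ) * (sqHi (F.P K).L (cornerP (F.P K) Mc ρ idx) (sideP (F.P K) Mc ρ) ρ j 1 i + 1) + (((F.P K).L : ℤ) - 1))
    else sqHi (F.P K).L (cornerP (F.P K) Mc ρ idx) (sideP (F.P K) Mc ρ) ρ j j' + 1 with hhi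
  have hlo0 : lo 0 = fun i => ((F.P K).L : ℤ) * (sqLo (F.P K).L (cornerP (F.P K) Mc ρ idx) ρ j 1 i - 1) := by simp [hlo]
  have hhi0 : hi 0 = fun i => ((F.P K).L : ℤ) * (sqHi (F.P K).L (cornerP (F.P K) Mc ρ idx) (sideP (F.P K) Mc ρ) ρ j 1 i + 1) + (((F.P K).L : ℤ) - 1) := by
    simp [hhi]
  have hloj : ∀ j', 1 ≤ j' → lo j' = sqLo (F.P K).L (cornerP (F.P K) Mc ρ idx) ρ j j' - 1 := fun j' hj' => by
    simp [hlo, Nat.one_le_iff_ne_zero.mp hj']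
  have hhij : ∀ j', 1 ≤ j' → hi j' = sqHi (F.P K).L (cornerP (F.P K) Mc ρ idx) (sideP (F.P K) Mc ρ) ρ j j' + 1 := fun j' hj' => by
    simp [hhi, Nat.one_le_iff_ne_zero.mp hj']
  -- `Ω″ ⊆ □` levelwise (the meet is finer than the cube tower), hence the boxed ends (dag-n07-w4)
  have hsub : ∀ j', 1 ≤ j' → D''.Om j' ⊆ (cubeDomains (F.P K) (cornerP (F.P K) Mc ρ idx) (sideP (F.P K) Mc ρ) ρ j hk).Om j' :=
    fun j' _ => domainsMeet_le_left _ _ j'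
  obtain ⟨hO, hS, -⟩ := levelBoxes_of_Om_subset_cubeDomains (P := F.P K) hLρ D'' hsub hlo0 hhi0 hloj hhij
  have hlt : j < D''.k + 1 := by
    show j < min j j + 1
    rw [min_self]; exact Nat.lt_succ_self j
  -- both ends of `c` lie in the level-`j` box `[lo j, hi j]`
  have hend : ∀ y : Site (F.P K) j, (y = c.src ∨ y = c.tgt) → y ∈ (castSite '' Set.Icc (lo j) (hi j) : Set (Site (F.P K) j)) := by
    intro y hy
    by_cases hmem : y ∈ D''.Om j
    · have hnd : ¬ D''.Deep j y := by
        rcases hy with rfl | rfl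
        · exact hc.2.1
        · exact hc.2.2
      exact hS j hj1 y ⟨hmem, hnd⟩
    · have hOc := hO ⟨⟨⟨j, hlt⟩, c⟩, hc⟩
      rcases hy with rfl | rfl
      · exact hOc.1 hmem
      · exact hOc.2 hmem
  have hs : c.src ∈ (castSite '' Set.Icc (lo j) (hi j) : Set (Site (F.P K) j)) := hend _ (Or.inl rfl)
  have ht : c.tgt ∈ (castSite '' Set.Icc (lo j) (hi j) : Set (Site (F.P K) j)) := hend _ (Or.inr rfl)
  rw [hloj j hj1, hhij j hj1] at hs ht
  -- a non-wrapping box: two boxed ends make a box bond (dag-n07-w6)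
  have hNwrap : ∀ κ, (sqHi (F.P K).L (cornerP (F.P K) Mc ρ idx) (sideP (F.P K) Mc ρ) ρ j j + 1) κ + 1 -
      (sqLo (F.P K).L (cornerP (F.P K) Mc ρ idx) ρ j j - 1) κ < (F.P K).sitesPerDir j := fun κ => by
    have := hn κ; omega
  have hb := mem_boxBonds_of_ends_mem_box (P := F.P K) hNwrap hs ht
  have hnN' : n < (F.P K).sitesPerDir j := by omega
  -- MODULE 40's (160)-I row for the log-like datum `log`, `C = 2`, `r = ½`
  exact norm_datum_dataAxial_le (fun x : SU N => mlog (x : MatA N)) (C := 2) (r := 1 / 2) (by norm_num)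
    (fun x hx => norm_mlog_le_two_mul hx) _ subset_rfl hV hδ hn hnN' hr hb

end Summit.QuantumFields.YangMills.BalabanUVNodes.N07NormalisationTopRows

end
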